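import Summits.ResolutionOfSingularities.ResolutionOfSingularities.Theorems.WildConesCampaignW46ChartPoint
import HarnessLib

/-!
# [OURS · L1 W4.6 rung (iii-2), NON-RATIONAL POINTS, brick 3] The prime of a NON-RATIONAL closed point of the exceptional divisor lying
# on a coordinate line: `𝔓 = (ψ cᵢ) + (u_j : j ≠ i, y) + (π̃^ψ(u_y))`, `π̃ ∈ R[X]` monic with irreducible reduction; the residue field
# is `κ[X]/(π)`

Cell `res-hironaka`, LADDER-RESOLUTION rung L (D-0089), slot W4.6 rung (iii); seat res-L1-s46-pv-6 (gen 7). Host route MarkedTransfer,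
`--supports stmt-ResolutionOfSingularities-16155 --as helper`; kind proof (no definition). NON-RATIONAL twin of res-L1-s46-pv-2's brick 4
(`ChartPoint.prime_eq_span_of_rational`, `…maximalIdeal_eq_of_rational`, `…exists_sub_algebraMap_mem_maximalIdeal_of_rational`) over the
same ABSTRACT chart data `(A, ψ, u, ε : (R/(c))[T_j : j ≠ i] ≅ A/(ψ cᵢ))` of `BlowupChartRsop.lean`. Pure commutative algebra; NOTHING here
is a statement of H. Hironaka's manuscript [Hironaka2017] and nothing of it is used; no FACT-LIST premise. AI-written; AI review is weaker
than expert review.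

## Statement (`exists_monic_of_isMaximal`)

Let `𝔓 ⊂ A` be a MAXIMAL ideal over `𝔪_R = (c)` containing the quotients `u_j` for all `j ≠ i, y` (the closed point of the exceptional
divisor `A/(ψ cᵢ) ≅ κ[T]` lies on the `T_y`-axis; in the application — a singular point of the controlled transform of `z^p + F(u)`, `ord F > p`
— this is forced by `z/uᵢ ∈ 𝔪`). Killing the `T_j`, `j ≠ y`, maps `A ↠ κ[X]` (`Θ`, `u_y ↦ X`) with kernel inside `N = (ψ cᵢ) + (u_j)`,
so `𝔓 ↦` a maximal ideal of the PID `κ[X]`, generated by a monic irreducible `π`; lifting its coefficients to `R`: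
* `𝔓 = (ψ cᵢ) ⊔ (u_j : j ≠ i, y) ⊔ (π̃^ψ(u_y))`, `π̃ ∈ R[X]` monic with `π̃ mod 𝔪_R = π` irreducible;
* every `x ∈ A` is `≡ P̃^ψ(u_y)` modulo `N ⊆ 𝔓` for some `P̃ ∈ R[X]` (the residue field `A/𝔓 = κ[X]/(π)` is generated by `u_y`);
* every `x ∉ 𝔓` has an inverse of that shape modulo `𝔓`;
and (`span_eq_maximalIdeal_of_isMaximal_nr`, `exists_sub_algebraMap_eval_mem_maximalIdeal_nr`) the same read in a localisation `L` of `A`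
at `𝔓` (the stalk `𝒪_{Z′,ξ′}`): `𝔪_L = (ψ cᵢ, u_j, π̃^ψ(u_y))` and every element of `L` is `≡ P̃^ψ(u_y)` modulo `𝔪_L`. These are the
hypotheses `hgen` / `hres` of the non-rational ring-level step `…FormalNRStepCore.exists_ringEquiv_transform_seriesAnchor_nr`.

References: The Stacks Project, Tags 0804, 00FW; H. Matsumura, *Commutative Ring Theory* (1986) §5; tree `BlowupChartRsop.lean`,
`WildConesCampaignW46ChartPoint.lean`. H. Hironaka, ms. 2017, Th. 16.6 p.84 — ROLE of «the closed point `ξ′ ∈ π⁻¹(ξ)` of the blowup» only,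
under adjudication, not cited as fact. [StacksProject] [Matsumura1987] [folklore]
-/

noncomputable section

set_option linter.dupNamespace false -- mandated namespace of this single-conjunct summit

open IsLocalRing

namespace Summit.ResolutionOfSingularities.ResolutionOfSingularities.Theorems

namespace CampaignW46

namespace MohWindowShadeFormalNR

universe u

section Abstract

variable {R : Type u} [CommRing R] [IsLocalRing R] {n : ℕ} (c : Fin n → R) (i : Fin n)
  (hz : Ideal.span (Set.range c) = maximalIdeal R)
  {A : Type u} [CommRing A] (ψ : R →+* A) (u : Fin n → A)
  (ε : MvPolynomial {j : Fin n // j ≠ i} (R ⧸ Ideal.span (Set.range c)) ≃+* A ⧸ Ideal.span {ψ (c i)})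
  (hεC : ∀ r : R, ε (MvPolynomial.C (Ideal.Quotient.mk (Ideal.span (Set.range c)) r)) =
    Ideal.Quotient.mk _ (ψ r))
  (hεX : ∀ j : {j : Fin n // j ≠ i}, ε (MvPolynomial.X j) = Ideal.Quotient.mk _ (u j.1))
  {y : Fin n} (hy : y ≠ i)

include hz hεC hεX hy in
/-- [OURS · L1 W4.6 — DICTIONARY AT A NON-RATIONAL POINT, brick 3 (abstract chart); replaces the role of «the closed point `ξ′ ∈ π⁻¹(ξ)` of
the blowup» (H. Hironaka, ms. 2017, Th. 16.6 p.84 l.10) AT A NON-RATIONAL POINT ON A COORDINATE LINE of the exceptional divisor; NOT a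
statement of the manuscript] **The prime of a non-rational closed point on the `T_y`-axis.** See the module docstring.
[cite: StacksProject, Tag 00FW] [folklore] -/
theorem exists_monic_of_isMaximal (𝔓 : Ideal A) [h𝔓M : 𝔓.IsMaximal] (h𝔓 : 𝔓.comap ψ = maximalIdeal R)
    (hu : ∀ j, j ≠ i → j ≠ y → u j ∈ 𝔓) :
    ∃ πR : Polynomial R, πR.Monic ∧ Irreducible (πR.map (Ideal.Quotient.mk (Ideal.span (Set.range c)))) ∧
      𝔓 = (Ideal.span {ψ (c i)} ⊔ Ideal.span (Set.range fun j : {j : Fin n // j ≠ i ∧ j ≠ y} => u j.1)) ⊔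
        Ideal.span {(πR.map ψ).eval (u y)} ∧
      (∀ x : A, ∃ P : Polynomial R, x - (P.map ψ).eval (u y) ∈
        Ideal.span {ψ (c i)} ⊔ Ideal.span (Set.range fun j : {j : Fin n // j ≠ i ∧ j ≠ y} => u j.1)) ∧
      (∀ x : A, x ∉ 𝔓 → ∃ Q : Polynomial R, x * (Q.map ψ).eval (u y) - 1 ∈ 𝔓) := by
  classical
  -- the residue field `κ = R/(c)` and the projection `Θ : A → κ[X]` killing `T_j`, `j ≠ y`
  haveI hmax : (Ideal.span (Set.range c)).IsMaximal := by rw [hz]; exact IsLocalRing.maximalIdeal.isMaximal R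
  set κ := R ⧸ Ideal.span (Set.range c) with hκ
  letI hfield : Field κ := Ideal.Quotient.field _
  haveI : IsPrincipalIdealRing (Polynomial κ) := EuclideanDomain.to_principal_ideal_domain
  set mk : R →+* κ := Ideal.Quotient.mk (Ideal.span (Set.range c)) with hmk
  set θ : MvPolynomial {j : Fin n // j ≠ i} κ →ₐ[κ] Polynomial κ :=
    MvPolynomial.aeval (fun j : {j : Fin n // j ≠ i} => if j.1 = y then (Polynomial.X : Polynomial κ) else 0) with hθ
  set ιy : Polynomial κ →ₐ[κ] MvPolynomial {j : Fin n // j ≠ i} κ := Polynomial.aeval (MvPolynomial.X ⟨y, hy⟩) with hιy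
  have hθX : ∀ j : {j : Fin n // j ≠ i}, θ (MvPolynomial.X j) = if j.1 = y then (Polynomial.X : Polynomial κ) else 0 := fun j => by
    rw [hθ, MvPolynomial.aeval_X]
  have hθC : ∀ a : κ, θ (MvPolynomial.C a) = Polynomial.C a := fun a => by rw [hθ, MvPolynomial.algHom_C]; rfl
  have hθι : ∀ P : Polynomial κ, θ (ιy P) = P := by
    intro P
    have hcomp : θ.comp ιy = AlgHom.id κ (Polynomial κ) := by
      refine Polynomial.algHom_ext ?_
      rw [AlgHom.comp_apply, hιy, Polynomial.aeval_X, hθX, if_pos rfl, AlgHom.id_apply]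
    exact congrArg (fun χ => χ P) hcomp
  -- the ideal of killed variables and `q ≡ ιy (θ q)` modulo it
  set I : Ideal (MvPolynomial {j : Fin n // j ≠ i} κ) := Ideal.span (Set.range fun j : {j : Fin n // j ≠ i ∧ j ≠ y} =>
    (MvPolynomial.X ⟨j.1, j.2.1⟩ : MvPolynomial {j : Fin n // j ≠ i} κ)) with hI
  have hqI : ∀ q, q - ιy (θ q) ∈ I := by
    intro q
    have hcomp : (Ideal.Quotient.mkₐ κ I) = (Ideal.Quotient.mkₐ κ I).comp (ιy.comp θ) := by
      refine MvPolynomial.algHom_ext fun j => ?_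
      rw [AlgHom.comp_apply, AlgHom.comp_apply, hθX]
      by_cases hj : j.1 = y
      · have hjj : j = ⟨y, hy⟩ := Subtype.ext hj
        rw [if_pos hj, hιy, Polynomial.aeval_X, hjj]
      · rw [if_neg hj, map_zero, Ideal.Quotient.mkₐ_eq_mk, map_zero, Ideal.Quotient.eq_zero_iff_mem]
        exact Ideal.subset_span ⟨⟨j.1, j.2, hj⟩, rfl⟩
    have := congrArg (fun χ => χ q) hcomp
    simp only [AlgHom.comp_apply, Ideal.Quotient.mkₐ_eq_mk] at this
    rw [← Ideal.Quotient.eq]; exact this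
  set Θ : A →+* Polynomial κ := θ.toRingHom.comp (ε.symm.toRingHom.comp (Ideal.Quotient.mk (Ideal.span {ψ (c i)}))) with hΘ
  have hΘapp : ∀ x, Θ x = θ (ε.symm (Ideal.Quotient.mk (Ideal.span {ψ (c i)}) x)) := fun x => rfl
  have hΘψ : ∀ r : R, Θ (ψ r) = Polynomial.C (mk r) := fun r => by
    rw [hΘapp, ← hεC, RingEquiv.symm_apply_apply, hθC]
  have hΘy : Θ (u y) = Polynomial.X := by
    rw [hΘapp, ← hεX ⟨y, hy⟩, RingEquiv.symm_apply_apply, hθX, if_pos rfl]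
  have hΘP : ∀ P : Polynomial R, Θ ((P.map ψ).eval (u y)) = P.map mk := fun P => by
    rw [Polynomial.eval_map, Polynomial.hom_eval₂, hΘy, ← Polynomial.eval_map]
    have hcomp : Θ.comp ψ = (Polynomial.C : κ →+* Polynomial κ).comp mk := RingHom.ext fun r => by rw [RingHom.comp_apply, hΘψ]; rfl
    rw [hcomp, ← Polynomial.map_map, Polynomial.eval_map, Polynomial.eval₂_C_X]
  have hlift : ∀ P : Polynomial κ, ∃ Pt : Polynomial R, Pt.map mk = P := fun P => Polynomial.map_surjective mk Ideal.Quotient.mk_surjective P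
  have hΘsurj : Function.Surjective Θ := fun P => by
    obtain ⟨Pt, hPt⟩ := hlift P
    exact ⟨(Pt.map ψ).eval (u y), by rw [hΘP, hPt]⟩
  -- the kernel of `Θ` lies in `N = (ψ cᵢ) + (u_j : j ≠ i, y)`
  set N : Ideal A := Ideal.span {ψ (c i)} ⊔ Ideal.span (Set.range fun j : {j : Fin n // j ≠ i ∧ j ≠ y} => u j.1) with hN
  have hkerN : ∀ x, Θ x = 0 → x ∈ N := by
    intro x hx
    set q := ε.symm (Ideal.Quotient.mk (Ideal.span {ψ (c i)}) x) with hq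
    have hθq : θ q = 0 := hx
    have hqI' : q ∈ I := by have := hqI q; rwa [hθq, map_zero, sub_zero] at this
    have h1 : Ideal.Quotient.mk (Ideal.span {ψ (c i)}) x = ε q := by rw [hq, RingEquiv.apply_symm_apply]
    have h2 : (ε : _ →+* A ⧸ Ideal.span {ψ (c i)}) q ∈ I.map (ε : _ →+* A ⧸ Ideal.span {ψ (c i)}) := Ideal.mem_map_of_mem _ hqI'
    rw [hI, Ideal.map_span, ← Set.range_comp] at h2
    have hfun : ((⇑(ε : MvPolynomial {j : Fin n // j ≠ i} κ →+* A ⧸ Ideal.span {ψ (c i)})) ∘ fun j : {j : Fin n // j ≠ i ∧ j ≠ y} =>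
        (MvPolynomial.X ⟨j.1, j.2.1⟩ : MvPolynomial {j : Fin n // j ≠ i} κ)) =
        (⇑(Ideal.Quotient.mk (Ideal.span {ψ (c i)})) ∘ fun j : {j : Fin n // j ≠ i ∧ j ≠ y} => u j.1) := by
      funext j; rw [Function.comp_apply, Function.comp_apply, RingHom.coe_coe, hεX]
    rw [hfun, Set.range_comp, ← Ideal.map_span] at h2
    have h3 : Ideal.Quotient.mk (Ideal.span {ψ (c i)}) x ∈ Ideal.map (Ideal.Quotient.mk (Ideal.span {ψ (c i)}))
        (Ideal.span (Set.range fun j : {j : Fin n // j ≠ i ∧ j ≠ y} => u j.1)) := by rw [h1]; exact h2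
    rw [← Ideal.mem_comap, Ideal.comap_map_of_surjective _ Ideal.Quotient.mk_surjective, ← RingHom.ker_eq_comap_bot, Ideal.mk_ker] at h3
    rw [hN, sup_comm]; exact h3
  have hKP : Ideal.span {ψ (c i)} ≤ 𝔓 := by
    rw [Ideal.span_singleton_le_iff_mem, ← Ideal.mem_comap, h𝔓, ← hz]; exact Ideal.subset_span ⟨i, rfl⟩
  have hNP : N ≤ 𝔓 := by
    refine sup_le hKP ?_
    rw [Ideal.span_le]; rintro _ ⟨j, rfl⟩; exact hu j.1 j.2.1 j.2.2
  have hcong : ∀ x : A, ∃ P : Polynomial R, x - (P.map ψ).eval (u y) ∈ N := by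
    intro x
    obtain ⟨Pt, hPt⟩ := hlift (Θ x)
    exact ⟨Pt, hkerN _ (by rw [map_sub, hΘP, hPt, sub_self])⟩
  -- the image of `𝔓`: a maximal ideal of the PID `κ[X]`, with monic irreducible generator
  set 𝔫 : Ideal (Polynomial κ) := 𝔓.map Θ with h𝔫
  have hcomap : 𝔫.comap Θ = 𝔓 := by
    rw [h𝔫, Ideal.comap_map_of_surjective _ hΘsurj, sup_eq_left]
    intro x hx; exact hNP (hkerN x (by simpa [RingHom.mem_ker] using hx))
  have h𝔫max : 𝔫.IsMaximal := by
    rcases Ideal.map_eq_top_or_isMaximal_of_surjective Θ hΘsurj h𝔓M with h | h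
    · exfalso
      have h1 : (1 : A) ∈ 𝔫.comap Θ := by
        rw [Ideal.mem_comap, map_one]
        have : 𝔫 = ⊤ := h
        rw [this]; trivial
      rw [hcomap] at h1
      exact h𝔓M.ne_top ((Ideal.eq_top_iff_one _).mpr h1)
    · exact h
  haveI : 𝔫.IsPrincipal := IsPrincipalIdealRing.principal 𝔫
  set π₀ := Submodule.IsPrincipal.generator 𝔫 with hπ₀
  have h𝔫π₀ : 𝔫 = Ideal.span {π₀} := (Ideal.span_singleton_generator 𝔫).symm
  have hπ₀0 : π₀ ≠ 0 := by
    intro h0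
    rw [h0, Ideal.span_singleton_eq_bot.mpr rfl] at h𝔫π₀
    rw [h𝔫π₀] at h𝔫max
    exact Polynomial.not_isField κ (Ring.isField_iff_maximal_bot.mpr h𝔫max)
  have hπ₀irr : Irreducible π₀ := by
    have hprime : Prime π₀ := (Ideal.span_singleton_prime hπ₀0).mp (h𝔫π₀ ▸ h𝔫max.isPrime)
    exact hprime.irreducible
  set π := π₀ * Polynomial.C (π₀.leadingCoeff)⁻¹ with hπ
  have hπm : π.Monic := Polynomial.monic_mul_leadingCoeff_inv hπ₀0
  have hCunit : IsUnit (Polynomial.C (π₀.leadingCoeff)⁻¹) :=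
    Polynomial.isUnit_C.mpr (IsUnit.inv (isUnit_iff_ne_zero.mpr (Polynomial.leadingCoeff_ne_zero.mpr hπ₀0)))
  have hπirr : Irreducible π := (irreducible_mul_isUnit hCunit).mpr hπ₀irr
  have h𝔫π : 𝔫 = Ideal.span {π} := by rw [h𝔫π₀, hπ, Ideal.span_singleton_mul_right_unit hCunit]
  -- lift `π` to a monic `π̃ ∈ R[X]`
  obtain ⟨πR, hπRmap, -, hπRm⟩ := Polynomial.lifts_and_natDegree_eq_and_monic ((Polynomial.mem_lifts _).mpr (hlift π)) hπm
  have hΘπR : Θ ((πR.map ψ).eval (u y)) = π := by rw [hΘP, hπRmap]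
  have hπR𝔓 : (πR.map ψ).eval (u y) ∈ 𝔓 := by
    rw [← hcomap, Ideal.mem_comap, hΘπR, h𝔫π]; exact Ideal.subset_span rfl
  refine ⟨πR, hπRm, by rw [hπRmap]; exact hπirr, ?_, hcong, ?_⟩
  · -- `𝔓 = N ⊔ (π̃^ψ(u_y))`
    refine le_antisymm ?_ (sup_le hNP (by rw [Ideal.span_singleton_le_iff_mem]; exact hπR𝔓))
    intro x hx
    have h1 : Θ x ∈ Ideal.span {π} := by rw [← h𝔫π, h𝔫]; exact Ideal.mem_map_of_mem _ hx
    obtain ⟨t, ht⟩ := Ideal.mem_span_singleton'.mp h1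
    obtain ⟨tt, htt⟩ := hΘsurj t
    have h2 : x - tt * (πR.map ψ).eval (u y) ∈ N := hkerN _ (by rw [map_sub, map_mul, htt, hΘπR, ht, sub_self])
    have e1 : x = (x - tt * (πR.map ψ).eval (u y)) + tt * (πR.map ψ).eval (u y) := by ring
    rw [e1]
    exact Ideal.add_mem _ (Ideal.mem_sup_left h2) (Ideal.mem_sup_right (Ideal.mul_mem_left _ _ (Ideal.subset_span rfl)))
  · -- inverses modulo `𝔓`
    intro x hx
    have hΘx : Θ x ∉ 𝔫 := fun h => hx (by rw [← hcomap, Ideal.mem_comap]; exact h)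
    obtain ⟨b, w, hw, hbw⟩ := h𝔫max.exists_inv hΘx
    obtain ⟨Qt, hQt⟩ := hlift b
    refine ⟨Qt, ?_⟩
    rw [← hcomap, Ideal.mem_comap, map_sub, map_mul, map_one, hΘP, hQt]
    have e1 : Θ x * b - 1 = -w := by rw [← hbw]; ring
    rw [e1]
    exact 𝔫.neg_mem hw

include hz hεC hεX hy in
/-- [OURS · L1 W4.6 — brick 3 at the local ring; NOT a statement of the manuscript] **The maximal ideal of the local ring at a non-rational
point on the `T_y`-axis** is generated by the exceptional parameter `ψ cᵢ`, the quotients `u_j` (`j ≠ i, y`) and `π̃^ψ(u_y)`; every element of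
the local ring is an `R`-polynomial in `u_y` modulo `𝔪_L`. Hypotheses `hgen` / `hres` of `…FormalNRStepCore.exists_ringEquiv_transform_seriesAnchor_nr`
before completion. [cite: StacksProject, Tag 00FW] [folklore] -/
theorem exists_monic_of_isMaximal_localization (𝔓 : Ideal A) [𝔓.IsMaximal] (h𝔓 : 𝔓.comap ψ = maximalIdeal R)
    (hu : ∀ j, j ≠ i → j ≠ y → u j ∈ 𝔓)
    (L : Type u) [CommRing L] [IsLocalRing L] [Algebra A L] [IsLocalization.AtPrime L 𝔓] :
    ∃ πR : Polynomial R, πR.Monic ∧ Irreducible (πR.map (Ideal.Quotient.mk (Ideal.span (Set.range c)))) ∧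
      maximalIdeal L = (Ideal.span {algebraMap A L (ψ (c i))} ⊔
        Ideal.span (Set.range fun j : {j : Fin n // j ≠ i ∧ j ≠ y} => algebraMap A L (u j.1))) ⊔
        Ideal.span {algebraMap A L ((πR.map ψ).eval (u y))} ∧
      ∀ yL : L, ∃ P : Polynomial R, yL - algebraMap A L ((P.map ψ).eval (u y)) ∈ maximalIdeal L := by
  obtain ⟨πR, hm, hirr, hP, hcong, hinv⟩ := exists_monic_of_isMaximal c i hz ψ u ε hεC hεX hy 𝔓 h𝔓 hu
  have hmax : 𝔓.map (algebraMap A L) = maximalIdeal L := IsLocalization.AtPrime.map_eq_maximalIdeal 𝔓 L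
  refine ⟨πR, hm, hirr, ?_, fun yL => ?_⟩
  · rw [← hmax, hP, Ideal.map_sup, Ideal.map_sup, Ideal.map_span, Set.image_singleton, Ideal.map_span, ← Set.range_comp, Ideal.map_span,
      Set.image_singleton]
    rfl
  · obtain ⟨⟨a, s⟩, hyL⟩ := IsLocalization.surj 𝔓.primeCompl yL
    obtain ⟨Pa, hPa⟩ := hcong a
    obtain ⟨Qs, hQs⟩ := hinv s.1 s.2
    refine ⟨Pa * Qs, ?_⟩
    have hNP : Ideal.span {ψ (c i)} ⊔ Ideal.span (Set.range fun j : {j : Fin n // j ≠ i ∧ j ≠ y} => u j.1) ≤ 𝔓 := by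
      refine sup_le ?_ ?_
      · rw [Ideal.span_singleton_le_iff_mem, ← Ideal.mem_comap, h𝔓, ← hz]; exact Ideal.subset_span ⟨i, rfl⟩
      · rw [Ideal.span_le]; rintro _ ⟨j, rfl⟩; exact hu j.1 j.2.1 j.2.2
    have h1 : algebraMap A L a - algebraMap A L ((Pa.map ψ).eval (u y)) ∈ maximalIdeal L := by
      rw [← map_sub, ← hmax]; exact Ideal.mem_map_of_mem _ (hNP hPa)
    have h2 : algebraMap A L (s.1 * (Qs.map ψ).eval (u y)) - 1 ∈ maximalIdeal L := by
      rw [← map_one (algebraMap A L), ← map_sub, ← hmax]; exact Ideal.mem_map_of_mem _ hQs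
    -- `yL · s = a`
    have e : yL - algebraMap A L (((Pa * Qs).map ψ).eval (u y)) =
        -(yL * (algebraMap A L (s.1 * (Qs.map ψ).eval (u y)) - 1)) +
          (algebraMap A L a - algebraMap A L ((Pa.map ψ).eval (u y))) * algebraMap A L ((Qs.map ψ).eval (u y)) := by
      rw [Polynomial.map_mul, Polynomial.eval_mul, map_mul, map_mul, ← hyL]; ring
    rw [e]
    exact Ideal.add_mem _ ((maximalIdeal L).neg_mem (Ideal.mul_mem_left _ _ h2)) (Ideal.mul_mem_right _ _ h1)

end Abstract

end MohWindowShadeFormalNR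

end CampaignW46

end Summit.ResolutionOfSingularities.ResolutionOfSingularities.Theorems

end
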